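import Summits.SmoothPoincare4.SmoothPoincare4.Theses.WeakReductionDescent
import Literature.Topology.FourManifolds.WeaklyReducibleTrisections
import Literature.Topology.FourManifolds.WeaklyReducibleTrisectionsNaturality
import Literature.Topology.FourManifolds.SphereTrisectionsSectors
import Literature.Topology.FourManifolds.TrisectionFunctorGKNaturality
import Literature.Topology.FourManifolds.TrisectionsStabilization
import Summits.SmoothPoincare4.SmoothPoincare4.Theorems.WeakReductionDescentMinimalWeaklyReducibleFromFourStubPigeonhole
import Summits.SmoothPoincare4.SmoothPoincare4.Theorems.WeakReductionDescentMinimalWeaklyReducibleFromFourStubTwoSided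
import Summits.SmoothPoincare4.SmoothPoincare4.Theorems.WeakReductionDescentMinimalWeaklyReducibleFromFourReduction

/-!
# `MinimalWeaklyReducibleFromFour`, line `Sketch` (spine KCap) — negative-side support for the apex
# `stub_sectorHaken`: what it costs (crux stmt-SmoothPoincare4-18019, cdisprove seat)

The picked line of crux X₂ (`Cruxes/MinimalWeaklyReducibleFromFour/Lines/Sketch.lean`, PICKED.md) closes
X₂ from three stubs, two landed (`stub_pigeonhole`, `stub_twoSided`) and the open apex `stub_sectorHaken`
("Haken's lemma for the third handlebody": for every GK-trisection of genus `g ≥ 4` of a smooth homotopy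
4-sphere and EVERY label `p` with `k p ≥ 2` there are a curve `δ ⊆ F` compressing in both `H_q` (`q ≠ p`),
two `p`-cores `c₁`, `c₂` (non-separating, compressing in both `H_q`) off `δ` and on different sides of it,
and a non-separating `p`-compressing curve `c` off `δ`).  The composition never consumes the crux's
MINIMALITY hypothesis.  This file records, kernel-checked, what the apex therefore asserts:

* `sphere_gkTrisection_three_one`, `sphere_gkTrisection_six_two`, `sectorHaken_hypotheses_satisfiable_sphere`
  — NON-VACUITY ON THE ROUND SPHERE.  Gay–Kirby's genus-`0` trisection of `S⁴`
  (`sphereSector_isBalancedGKTrisection_holds`, PROVED) stabilised twice (`IsGKTrisection.exists_stabilization`,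
  GK Lemma 10, PROVED) is a `(6; 2, 2, 2)` GK-trisection of the ROUND `S⁴`: genus `≥ 4` and `k p = 2` at
  every label.  So, unlike the crux (whose hypothesis "minimal of genus `≥ 4`" fails on every `M ≅ S⁴`,
  `Negative/RefutationCost.lean`), the apex's hypotheses are met on `S⁴` itself: the summit does not
  discharge the apex by vacuity.
* `sphere_isWeaklyReducible_of_sectorHaken` — THE APEX DECIDES A QUESTION ABOUT `S⁴`'S OWN TRISECTIONS:
  it implies that EVERY GK-trisection of the round `S⁴` of genus `≥ 4` is weakly reducible (pigeonhole +
  two-sidedness at `M = S⁴`, `e = refl`).  In print this is open: standard (= stabilised genus-`0`)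
  trisections of genus `≥ 2` are weakly reducible (take `c′` the doubly-compressing curve of one genus-1
  summand of type `p` and `c` a `p`-compressing curve of another summand), and "a major open problem in
  trisection theory is whether there exists a non-standard trisection of `S⁴`" (Aranda–Zupan,
  arXiv:2503.04607, p. 27, lines 14–22; Question 8.3 there asks for strongly irreducible genus-THREE
  trisections).  Consequently a KILL of the apex on a homotopy sphere `M` is either an exotic `S⁴`
  (`M ≇ S⁴`) or a NON-STANDARD trisection of `S⁴` (for a standard one the configuration exists at every
  label with `k p ≥ 2`: `δ` = the connected-sum curve separating two type-`p` summands, `c₁`, `c₂` their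
  doubly-compressing curves, `c` the `p`-compressing curve of the first summand) — the apex is shielded by
  `SmoothPoincare4 ∧ (4-dimensional Waldhausen: every trisection of S⁴ is standard)`, not by the summit
  alone; no finite certificate for "no balanced `δ` admits a disjoint `p`-compressing curve" is known
  ("current techniques for obstructing reducibility of non-minimal trisections are limited", ibid.).
* `sectorHaken_of_sphere_of_smoothPoincare4` — UNDER THE SUMMIT THE APEX IS EXACTLY ITS RESTRICTION TO
  THE ROUND SPHERE: `SmoothPoincare4 →` (apex for `M = S⁴`) `→` apex (transport of curves, compressing
  discs, non-separation and the two-sides clause along the diffeomorphism, using the PROVED naturality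
  lemmas of `WeaklyReducibleTrisectionsNaturality.lean`).  With the previous item: modulo the summit the
  apex is a statement of 4-dimensional Heegaard theory about `S⁴`, neither implied nor refuted by anything
  in the tree.
* `sectorHaken_sides_consequences` — READ-BACK OF THE TWO-SIDES CLAUSE: it forces `δ` to be SEPARATING on
  `F` (`¬ IsNonSeparating T δ`) and the cores `c₁`, `c₂` to be disjoint; so the apex asks for a separating
  reducing curve of the genus-`g` Heegaard splitting `∂X_p = H_q ∪_F H_r ≅ #^{k p}(S¹ × S²)` with a core on
  each side — which in print needs `k p ≥ 2` (for `k p ≤ 1` one side of a separating reducing sphere of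
  `#^{k p}(S¹ × S²)` is a punctured `S³`, and a curve compressing to both sides of a Heegaard surface of
  `S³` is separating): the hypothesis `2 ≤ k p` is load-bearing, the hypothesis `4 ≤ g` is not (given
  `2 ≤ k p`; e.g. the `(2; 2, 0, 0)` stabilisation of `S⁴` has the configuration) — paper analysis, see
  the crux work file `Cruxes/MinimalWeaklyReducibleFromFour/Disproof.lean`.
* `sectorHaken_false_without_trisection` — the trisection hypothesis of the apex is load-bearing (formal,
  junk witness: empty sectors on the round `S⁴`; a curve is the range of a map from the nonempty circle).

References: R. Aranda, A. Zupan, arXiv:2503.04607 (2025), §2 p. 6 and Remark 2.5 (weakly reducible),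
Lemma 2.2 (Haken's lemma), §8 p. 27 (non-standard trisections of `S⁴`; Questions 8.2, 8.3);
D. Gay, R. Kirby, Geom. Topol. 20 (2016), §2 (genus-0 trisection of `S⁴`), Def. 8 / Lemma 10
(stabilisation); J. Meier, T. Schirmer, A. Zupan, Proc. AMS 144 (2016), Remark 3.12, Conj. 3.11.
-/

noncomputable section

-- the prescribed namespace `Summit.<P>.<Sub>.…` duplicates `SmoothPoincare4` (P = Sub)
set_option linter.dupNamespace false

open scoped Manifold ContDiff Topology ContinuousMap
open Set
open Literature.Topology.FourManifolds
open Summit.SmoothPoincare4.SmoothPoincare4.Theses.WeakReductionDescent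
open Summit.SmoothPoincare4.SmoothPoincare4.Theorems.MinimalWeaklyReducibleFromFour.KCap
  (stub_pigeonhole stub_twoSided helper_kcap_of_sectorHaken isPreconnected_of_isCurve)

namespace Summit.SmoothPoincare4.SmoothPoincare4.Theorems.MinimalWeaklyReducibleFromFour.Negative

/-! ### Non-vacuity of the apex on the round sphere -/

/-- The central surface of Gay–Kirby's genus-`0` trisection of the round `S⁴` is nonempty (it is the
`2`-sphere `{z = 0}`; the point `(0, 0, 1, 0, 0)` lies on it). [cite: GayKirby2016, §2 (arXiv p. 5), first example] -/
theorem iInter_sphereSector_nonempty : (⋂ m, GayKirby.sphereSector m).Nonempty := by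
  rw [GayKirby.iInter_sphereSector_eq]
  refine ⟨⟨EuclideanSpace.single 2 1, ?_⟩, ?_, ?_⟩
  · simp
  · simp
  · simp

/-- **The round `S⁴` has a `(3; 1, 1, 1)` GK-trisection with nonempty central surface** (the genus-`0`
trisection stabilised once, Gay–Kirby Lemma 10 — both PROVED tree theorems). [cite: GayKirby2016, Def. 8 and Lemma 10] -/
theorem sphere_gkTrisection_three_one :
    ∃ T : Fin 3 → Set (Metric.sphere (0 : EuclideanSpace ℝ (Fin 5)) 1),
      IsGKTrisection (Metric.sphere (0 : EuclideanSpace ℝ (Fin 5)) 1) 3 (fun _ => 1) T ∧ (⋂ m, T m).Nonempty := by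
  have h0 : IsGKTrisection (Metric.sphere (0 : EuclideanSpace ℝ (Fin 5)) 1) 0 (fun _ => 0) GayKirby.sphereSector :=
    sphereSector_isBalancedGKTrisection_holds.isGKTrisection
  obtain ⟨T₁, hT₁, hne₁⟩ := h0.exists_stabilization iInter_sphereSector_nonempty
  exact ⟨T₁, by simpa using hT₁, hne₁⟩

/-- **The round `S⁴` has a `(6; 2, 2, 2)` GK-trisection with nonempty central surface** (stabilise
twice): genus `6 ≥ 4` and `k p = 2` at EVERY label `p`. [cite: GayKirby2016, Def. 8 and Lemma 10] -/
theorem sphere_gkTrisection_six_two :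
    ∃ T : Fin 3 → Set (Metric.sphere (0 : EuclideanSpace ℝ (Fin 5)) 1),
      IsGKTrisection (Metric.sphere (0 : EuclideanSpace ℝ (Fin 5)) 1) 6 (fun _ => 2) T ∧ (⋂ m, T m).Nonempty := by
  obtain ⟨T₁, hT₁, hne₁⟩ := sphere_gkTrisection_three_one
  obtain ⟨T₂, hT₂, hne₂⟩ := hT₁.exists_stabilization hne₁
  exact ⟨T₂, by simpa using hT₂, hne₂⟩

/-- **The apex binds on the round sphere.** The hypotheses of `stub_sectorHaken` — a smooth homotopy
4-sphere (here `S⁴` itself, `e = refl`), a GK-trisection of genus `≥ 4`, a label with `k p ≥ 2` — are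
satisfiable on the ROUND `S⁴`, at every label: in contrast with the crux, whose minimality hypothesis
fails on every `M ≅ S⁴`, the summit does not make the apex vacuous. [folklore] -/
theorem sectorHaken_hypotheses_satisfiable_sphere :
    ∃ (_ : (Metric.sphere (0 : EuclideanSpace ℝ (Fin 5)) 1) ≃ₕ (Metric.sphere (0 : EuclideanSpace ℝ (Fin 5)) 1))
      (g : ℕ) (k : Fin 3 → ℕ) (T : Fin 3 → Set (Metric.sphere (0 : EuclideanSpace ℝ (Fin 5)) 1)),
      IsGKTrisection (Metric.sphere (0 : EuclideanSpace ℝ (Fin 5)) 1) g k T ∧ 4 ≤ g ∧ ∀ p : Fin 3, 2 ≤ k p := by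
  obtain ⟨T, hT, -⟩ := sphere_gkTrisection_six_two
  exact ⟨ContinuousMap.HomotopyEquiv.refl _, 6, fun _ => 2, T, hT, by norm_num, fun _ => le_rfl⟩

/-! ### What the apex decides about the round sphere -/

/-- **The apex implies: every GK-trisection of the ROUND `S⁴` of genus `≥ 4` is weakly reducible**
(pigeonhole `stub_pigeonhole` and two-sidedness `helper_kcap_of_sectorHaken`, both landed, at `M = S⁴`,
`e = refl`).  In print this conclusion is open (true for standard trisections; a counterexample is a
non-standard trisection of `S⁴`, "a major open problem", Aranda–Zupan 2025 p. 27). [cite: ArandaZupan2025, §8 (p. 27) and §2 (p. 6)] -/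
theorem sphere_isWeaklyReducible_of_sectorHaken
    (hSH : ∀ (M : Type) [TopologicalSpace M] [T2Space M] [SecondCountableTopology M] [ChartedSpace (EuclideanSpace ℝ (Fin 4)) M] [IsManifold (𝓡 4) ((⊤ : ℕ∞) : WithTop ℕ∞) M], (M ≃ₕ (Metric.sphere (0 : EuclideanSpace ℝ (Fin 5)) 1)) → ∀ (g : ℕ) (k : Fin 3 → ℕ) (T : Fin 3 → Set M), Literature.Topology.FourManifolds.IsGKTrisection M g k T → 4 ≤ g → ∀ (p : Fin 3), 2 ≤ k p → ∃ (δ c₁ c₂ c : Set M), Literature.Topology.FourManifolds.Trisection.IsCurve T δ ∧ (∀ q : Fin 3, q ≠ p → Literature.Topology.FourManifolds.Trisection.BoundsDisc T (Literature.Topology.FourManifolds.Trisection.spineHandlebody T q) δ) ∧ (Literature.Topology.FourManifolds.Trisection.IsCurve T c₁ ∧ Literature.Topology.FourManifolds.Trisection.IsNonSeparating T c₁ ∧ ∀ q : Fin 3, q ≠ p → Literature.Topology.FourManifolds.Trisection.BoundsDisc T (Literature.Topology.FourManifolds.Trisection.spineHandlebody T q) c₁) ∧ (Literature.Topology.FourManifolds.Trisection.IsCurve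 T c₂ ∧ Literature.Topology.FourManifolds.Trisection.IsNonSeparating T c₂ ∧ ∀ q : Fin 3, q ≠ p → Literature.Topology.FourManifolds.Trisection.BoundsDisc T (Literature.Topology.FourManifolds.Trisection.spineHandlebody T q) c₂) ∧ Disjoint c₁ δ ∧ Disjoint c₂ δ ∧ (∀ S : Set M, S ⊆ Literature.Topology.FourManifolds.Trisection.centralSurfaceSet T \ δ → IsPreconnected S → c₁ ⊆ S → c₂ ⊆ S → False) ∧ Literature.Topology.FourManifolds.Trisection.IsCurve T c ∧ Literature.Topology.FourManifolds.Trisection.IsNonSeparating T c ∧ Literature.Topology.FourManifolds.Trisection.BoundsDisc T (Literature.Topology.FourManifolds.Trisection.spineHandlebody T p) c ∧ Disjoint c δ) :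
    ∀ (g : ℕ) (k : Fin 3 → ℕ) (T : Fin 3 → Set (Metric.sphere (0 : EuclideanSpace ℝ (Fin 5)) 1)),
      IsGKTrisection (Metric.sphere (0 : EuclideanSpace ℝ (Fin 5)) 1) g k T → 4 ≤ g →
        Trisection.IsWeaklyReducible T := by
  intro g k T hT hg
  obtain ⟨p, hp⟩ := stub_pigeonhole _ (ContinuousMap.HomotopyEquiv.refl _) g k T hT hg
  exact helper_kcap_of_sectorHaken hSH _ (ContinuousMap.HomotopyEquiv.refl _) g k T hT hg p hp

/-- In particular the apex settles, for the `(6; 2, 2, 2)` stabilisation and for every other genus-`≥ 4`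
GK-trisection the round sphere carries, that it is weakly reducible — a non-vacuous instance.
[cite: ArandaZupan2025, §2 (p. 6)] -/
theorem exists_sphere_instance_of_sectorHaken
    (hSH : ∀ (M : Type) [TopologicalSpace M] [T2Space M] [SecondCountableTopology M] [ChartedSpace (EuclideanSpace ℝ (Fin 4)) M] [IsManifold (𝓡 4) ((⊤ : ℕ∞) : WithTop ℕ∞) M], (M ≃ₕ (Metric.sphere (0 : EuclideanSpace ℝ (Fin 5)) 1)) → ∀ (g : ℕ) (k : Fin 3 → ℕ) (T : Fin 3 → Set M), Literature.Topology.FourManifolds.IsGKTrisection M g k T → 4 ≤ g → ∀ (p : Fin 3), 2 ≤ k p → ∃ (δ c₁ c₂ c : Set M), Literature.Topology.FourManifolds.Trisection.IsCurve T δ ∧ (∀ q : Fin 3, q ≠ p → Literature.Topology.FourManifolds.Trisection.BoundsDisc T (Literature.Topology.FourManifolds.Trisection.spineHandlebody T q) δ) ∧ (Literature.Topology.FourManifolds.Trisection.IsCurve T c₁ ∧ Literature.Topology.FourManifolds.Trisection.IsNonSeparating T c₁ ∧ ∀ q : Fin 3, q ≠ p → Literature.Topology.FourManifolds.Trisection.BoundsDisc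 T (Literature.Topology.FourManifolds.Trisection.spineHandlebody T q) c₁) ∧ (Literature.Topology.FourManifolds.Trisection.IsCurve T c₂ ∧ Literature.Topology.FourManifolds.Trisection.IsNonSeparating T c₂ ∧ ∀ q : Fin 3, q ≠ p → Literature.Topology.FourManifolds.Trisection.BoundsDisc T (Literature.Topology.FourManifolds.Trisection.spineHandlebody T q) c₂) ∧ Disjoint c₁ δ ∧ Disjoint c₂ δ ∧ (∀ S : Set M, S ⊆ Literature.Topology.FourManifolds.Trisection.centralSurfaceSet T \ δ → IsPreconnected S → c₁ ⊆ S → c₂ ⊆ S → False) ∧ Literature.Topology.FourManifolds.Trisection.IsCurve T c ∧ Literature.Topology.FourManifolds.Trisection.IsNonSeparating T c ∧ Literature.Topology.FourManifolds.Trisection.BoundsDisc T (Literature.Topology.FourManifolds.Trisection.spineHandlebody T p) c ∧ Disjoint c δ) :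
    ∃ T : Fin 3 → Set (Metric.sphere (0 : EuclideanSpace ℝ (Fin 5)) 1),
      IsGKTrisection (Metric.sphere (0 : EuclideanSpace ℝ (Fin 5)) 1) 6 (fun _ => 2) T ∧ Trisection.IsWeaklyReducible T := by
  obtain ⟨T, hT, -⟩ := sphere_gkTrisection_six_two
  exact ⟨T, hT, sphere_isWeaklyReducible_of_sectorHaken hSH 6 _ T hT (by norm_num)⟩

/-! ### Under the summit the apex is its restriction to the round sphere -/

/-- **`SmoothPoincare4 →` (apex on the round `S⁴`) `→` apex.**  Push the trisection of `M` forward along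
the diffeomorphism `Φ : M ≅ S⁴` the summit provides (`IsGKTrisection.image_diffeomorph'`), take the
configuration `(δ, c₁, c₂, c)` there, and pull it back along `Φ⁻¹`: curves, compressing discs,
non-separation, disjointness and the two-sides clause are natural under diffeomorphisms
(`WeaklyReducibleTrisectionsNaturality.lean`).  So the summit reduces the apex to — but does not settle —
a statement about `S⁴`'s own genus-`≥ 4` trisections. [cite: ArandaZupan2025, §2 (p. 6)] -/
theorem sectorHaken_of_sphere_of_smoothPoincare4 (hs : _root_.SmoothPoincare4)
    (hS : ∀ (g : ℕ) (k : Fin 3 → ℕ) (T : Fin 3 → Set (Metric.sphere (0 : EuclideanSpace ℝ (Fin 5)) 1)), Literature.Topology.FourManifolds.IsGKTrisection (Metric.sphere (0 : EuclideanSpace ℝ (Fin 5)) 1) g k T → 4 ≤ g → ∀ (p : Fin 3), 2 ≤ k p → ∃ (δ c₁ c₂ c : Set (Metric.sphere (0 : EuclideanSpace ℝ (Fin 5)) 1)), Literature.Topology.FourManifolds.Trisection.IsCurve T δ ∧ (∀ q : Fin 3, q ≠ p → Literature.Topology.FourManifolds.Trisection.BoundsDisc T (Literature.Topology.FourManifolds.Trisection.spineHandlebody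 T q) δ) ∧ (Literature.Topology.FourManifolds.Trisection.IsCurve T c₁ ∧ Literature.Topology.FourManifolds.Trisection.IsNonSeparating T c₁ ∧ ∀ q : Fin 3, q ≠ p → Literature.Topology.FourManifolds.Trisection.BoundsDisc T (Literature.Topology.FourManifolds.Trisection.spineHandlebody T q) c₁) ∧ (Literature.Topology.FourManifolds.Trisection.IsCurve T c₂ ∧ Literature.Topology.FourManifolds.Trisection.IsNonSeparating T c₂ ∧ ∀ q : Fin 3, q ≠ p → Literature.Topology.FourManifolds.Trisection.BoundsDisc T (Literature.Topology.FourManifolds.Trisection.spineHandlebody T q) c₂) ∧ Disjoint c₁ δ ∧ Disjoint c₂ δ ∧ (∀ S : Set (Metric.sphere (0 : EuclideanSpace ℝ (Fin 5)) 1), S ⊆ Literature.Topology.FourManifolds.Trisection.centralSurfaceSet T \ δ → IsPreconnected S → c₁ ⊆ S → c₂ ⊆ S → False) ∧ Literature.Topology.FourManifolds.Trisection.IsCurve T c ∧ Literature.Topology.FourManifolds.Trisection.IsNonSeparating T c ∧ Literature.Topology.FourManifolds.Trisection.BoundsDisc T (Literature.Topology.FourManifolds.Trisection.spineHandlebody T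 p) c ∧ Disjoint c δ) :
    ∀ (M : Type) [TopologicalSpace M] [T2Space M] [SecondCountableTopology M] [ChartedSpace (EuclideanSpace ℝ (Fin 4)) M] [IsManifold (𝓡 4) ((⊤ : ℕ∞) : WithTop ℕ∞) M], (M ≃ₕ (Metric.sphere (0 : EuclideanSpace ℝ (Fin 5)) 1)) → ∀ (g : ℕ) (k : Fin 3 → ℕ) (T : Fin 3 → Set M), Literature.Topology.FourManifolds.IsGKTrisection M g k T → 4 ≤ g → ∀ (p : Fin 3), 2 ≤ k p → ∃ (δ c₁ c₂ c : Set M), Literature.Topology.FourManifolds.Trisection.IsCurve T δ ∧ (∀ q : Fin 3, q ≠ p → Literature.Topology.FourManifolds.Trisection.BoundsDisc T (Literature.Topology.FourManifolds.Trisection.spineHandlebody T q) δ) ∧ (Literature.Topology.FourManifolds.Trisection.IsCurve T c₁ ∧ Literature.Topology.FourManifolds.Trisection.IsNonSeparating T c₁ ∧ ∀ q : Fin 3, q ≠ p → Literature.Topology.FourManifolds.Trisection.BoundsDisc T (Literature.Topology.FourManifolds.Trisection.spineHandlebody T q) c₁) ∧ (Literature.Topology.FourManifolds.Trisection.IsCurve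 T c₂ ∧ Literature.Topology.FourManifolds.Trisection.IsNonSeparating T c₂ ∧ ∀ q : Fin 3, q ≠ p → Literature.Topology.FourManifolds.Trisection.BoundsDisc T (Literature.Topology.FourManifolds.Trisection.spineHandlebody T q) c₂) ∧ Disjoint c₁ δ ∧ Disjoint c₂ δ ∧ (∀ S : Set M, S ⊆ Literature.Topology.FourManifolds.Trisection.centralSurfaceSet T \ δ → IsPreconnected S → c₁ ⊆ S → c₂ ⊆ S → False) ∧ Literature.Topology.FourManifolds.Trisection.IsCurve T c ∧ Literature.Topology.FourManifolds.Trisection.IsNonSeparating T c ∧ Literature.Topology.FourManifolds.Trisection.BoundsDisc T (Literature.Topology.FourManifolds.Trisection.spineHandlebody T p) c ∧ Disjoint c δ := by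
  intro M _ _ _ _ _ e g k T hT hg p hp
  obtain ⟨Φ⟩ := hs M ‹_› ‹_› e
  -- push forward
  set T' : Fin 3 → Set (Metric.sphere (0 : EuclideanSpace ℝ (Fin 5)) 1) := fun i => Φ '' T i with hT'def
  have hT' : IsGKTrisection (Metric.sphere (0 : EuclideanSpace ℝ (Fin 5)) 1) g k T' :=
    hT.image_diffeomorph' Φ
  obtain ⟨δ', c₁', c₂', c', hδ', hδ'b, hc₁', hc₂', hd₁', hd₂', hsides', hc', hc'ns, hc'b, hc'δ⟩ :=
    hS g k T' hT' hg p hp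
  -- pull back along `Ψ = Φ.symm`
  have hinjΦ : Function.Injective Φ := EquivLike.injective Φ
  have hinjΨ : Function.Injective Φ.symm := EquivLike.injective Φ.symm
  have hback : (fun i => Φ.symm '' T' i) = T := by
    funext i
    simp [hT'def, Set.image_image]
  have hΦΨ : ∀ s : Set (Metric.sphere (0 : EuclideanSpace ℝ (Fin 5)) 1), Φ '' (Φ.symm '' s) = s := by
    intro s
    simp [Set.image_image]
  -- transport of the four kinds of clauses
  have curve : ∀ {a}, Trisection.IsCurve T' a → Trisection.IsCurve T (Φ.symm '' a) := by
    intro a ha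
    have h := ha.image_diffeomorph Φ.symm
    rwa [hback] at h
  have disc : ∀ {a} (q : Fin 3), Trisection.BoundsDisc T' (Trisection.spineHandlebody T' q) a →
      Trisection.BoundsDisc T (Trisection.spineHandlebody T q) (Φ.symm '' a) := by
    intro a q ha
    have h := ha.image_diffeomorph Φ.symm
    rw [← Trisection.spineHandlebody_image T' hinjΨ q, hback] at h
    exact h
  have nonsep : ∀ {a}, Trisection.IsNonSeparating T' a → Trisection.IsNonSeparating T (Φ.symm '' a) := by
    intro a ha
    have h := ha.image_homeomorph Φ.symm.toHomeomorph
    simp only [Diffeomorph.coe_toHomeomorph] at h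
    rwa [hback] at h
  have disj : ∀ {a b : Set (Metric.sphere (0 : EuclideanSpace ℝ (Fin 5)) 1)}, Disjoint a b →
      Disjoint (Φ.symm '' a) (Φ.symm '' b) := fun h => (Set.disjoint_image_iff hinjΨ).2 h
  refine ⟨Φ.symm '' δ', Φ.symm '' c₁', Φ.symm '' c₂', Φ.symm '' c', curve hδ', fun q hq => disc q (hδ'b q hq),
    ⟨curve hc₁'.1, nonsep hc₁'.2.1, fun q hq => disc q (hc₁'.2.2 q hq)⟩,
    ⟨curve hc₂'.1, nonsep hc₂'.2.1, fun q hq => disc q (hc₂'.2.2 q hq)⟩, disj hd₁', disj hd₂', ?_,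
    curve hc', nonsep hc'ns, disc p hc'b, disj hc'δ⟩
  -- the two-sides clause
  intro S hS hSpc h₁ h₂
  refine hsides' (Φ '' S) ?_ (hSpc.image Φ Φ.continuous.continuousOn) ?_ ?_
  · rintro _ ⟨x, hx, rfl⟩
    obtain ⟨hxF, hxδ⟩ := hS hx
    refine ⟨?_, fun hΦx => hxδ ⟨Φ x, hΦx, by simp⟩⟩
    rw [Trisection.centralSurfaceSet_image T (EquivLike.bijective Φ)]
    exact mem_image_of_mem Φ hxF
  · calc c₁' = Φ '' (Φ.symm '' c₁') := (hΦΨ c₁').symm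
      _ ⊆ Φ '' S := image_mono h₁
  · calc c₂' = Φ '' (Φ.symm '' c₂') := (hΦΨ c₂').symm
      _ ⊆ Φ '' S := image_mono h₂

/-! ### Read-back of the two-sides clause -/

/-- **The two-sides clause makes `δ` separating and the cores disjoint.** If no preconnected subset of
`F ∖ δ` contains both cores `c₁`, `c₂` (curves off `δ`), then `F ∖ δ` is not connected (`δ` is a
SEPARATING curve of the central surface — so a separating reducing curve of the Heegaard splitting
`∂X_p = H_q ∪_F H_r` when it compresses on both sides) and `c₁ ∩ c₂ = ∅` (each core is preconnected).
[cite: ArandaZupan2025, §2 (p. 6)] -/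
theorem sectorHaken_sides_consequences {M : Type} [TopologicalSpace M]
    [ChartedSpace (EuclideanSpace ℝ (Fin 4)) M] {T : Fin 3 → Set M} {δ c₁ c₂ : Set M}
    (hc₁ : Trisection.IsCurve T c₁) (hc₂ : Trisection.IsCurve T c₂) (hd₁ : Disjoint c₁ δ)
    (hd₂ : Disjoint c₂ δ)
    (hsides : ∀ S : Set M, S ⊆ Trisection.centralSurfaceSet T \ δ → IsPreconnected S → c₁ ⊆ S → c₂ ⊆ S → False) :
    ¬ Trisection.IsNonSeparating T δ ∧ Disjoint c₁ c₂ ∧ c₁ ≠ c₂ := by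
  have h₁F : c₁ ⊆ Trisection.centralSurfaceSet T \ δ :=
    fun z hz => ⟨hc₁.1 hz, fun hzδ => Set.disjoint_left.1 hd₁ hz hzδ⟩
  have h₂F : c₂ ⊆ Trisection.centralSurfaceSet T \ δ :=
    fun z hz => ⟨hc₂.1 hz, fun hzδ => Set.disjoint_left.1 hd₂ hz hzδ⟩
  have hdisj : Disjoint c₁ c₂ := by
    by_contra hnd
    obtain ⟨x, hx₁, hx₂⟩ := Set.not_disjoint_iff.1 hnd
    exact hsides (c₁ ∪ c₂) (union_subset h₁F h₂F)
      ((isPreconnected_of_isCurve hc₁).union x hx₁ hx₂ (isPreconnected_of_isCurve hc₂))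
      subset_union_left subset_union_right
  refine ⟨fun hns => hsides _ subset_rfl hns.isPreconnected h₁F h₂F, hdisj, ?_⟩
  rintro rfl
  obtain ⟨-, γ, -, hγ⟩ := hc₁
  obtain ⟨x, hx⟩ := (NormedSpace.sphere_nonempty (x := (0 : EuclideanSpace ℝ (Fin 2))) (r := 1)).mpr
    zero_le_one
  have hmem : γ ⟨x, hx⟩ ∈ c₁ := hγ ▸ mem_range_self _
  exact Set.disjoint_left.1 hdisj hmem hmem

/-! ### The trisection hypothesis of the apex is load-bearing (junk witness) -/

/-- **`stub_sectorHaken` without `IsGKTrisection M g k T` is FALSE**: on the round `S⁴` with EMPTY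
sectors (and `g = 4`, `k = 2`) the central surface is empty, while the curve `δ` would be the range of a
map from the nonempty circle.  Any proof of the apex must use the trisection hypothesis. [folklore] -/
theorem sectorHaken_false_without_trisection :
    ¬ (∀ (M : Type) [TopologicalSpace M] [T2Space M] [SecondCountableTopology M] [ChartedSpace (EuclideanSpace ℝ (Fin 4)) M] [IsManifold (𝓡 4) ((⊤ : ℕ∞) : WithTop ℕ∞) M], (M ≃ₕ (Metric.sphere (0 : EuclideanSpace ℝ (Fin 5)) 1)) → ∀ (g : ℕ) (k : Fin 3 → ℕ) (T : Fin 3 → Set M), 4 ≤ g → ∀ (p : Fin 3), 2 ≤ k p → ∃ (δ c₁ c₂ c : Set M), Literature.Topology.FourManifolds.Trisection.IsCurve T δ ∧ (∀ q : Fin 3, q ≠ p → Literature.Topology.FourManifolds.Trisection.BoundsDisc T (Literature.Topology.FourManifolds.Trisection.spineHandlebody T q) δ) ∧ (Literature.Topology.FourManifolds.Trisection.IsCurve T c₁ ∧ Literature.Topology.FourManifolds.Trisection.IsNonSeparating T c₁ ∧ ∀ q : Fin 3, q ≠ p → Literature.Topology.FourManifolds.Trisection.BoundsDisc T (Literature.Topology.FourManifolds.Trisection.spineHandlebody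 T q) c₁) ∧ (Literature.Topology.FourManifolds.Trisection.IsCurve T c₂ ∧ Literature.Topology.FourManifolds.Trisection.IsNonSeparating T c₂ ∧ ∀ q : Fin 3, q ≠ p → Literature.Topology.FourManifolds.Trisection.BoundsDisc T (Literature.Topology.FourManifolds.Trisection.spineHandlebody T q) c₂) ∧ Disjoint c₁ δ ∧ Disjoint c₂ δ ∧ (∀ S : Set M, S ⊆ Literature.Topology.FourManifolds.Trisection.centralSurfaceSet T \ δ → IsPreconnected S → c₁ ⊆ S → c₂ ⊆ S → False) ∧ Literature.Topology.FourManifolds.Trisection.IsCurve T c ∧ Literature.Topology.FourManifolds.Trisection.IsNonSeparating T c ∧ Literature.Topology.FourManifolds.Trisection.BoundsDisc T (Literature.Topology.FourManifolds.Trisection.spineHandlebody T p) c ∧ Disjoint c δ) := by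
  intro h
  obtain ⟨δ, c₁, c₂, c, hδ, -⟩ := h (Metric.sphere (0 : EuclideanSpace ℝ (Fin 5)) 1)
    (ContinuousMap.HomotopyEquiv.refl _) 4 (fun _ => 2) (fun _ => ∅) le_rfl 0 le_rfl
  obtain ⟨hδF, γ, -, hγ⟩ := hδ
  have hF : Trisection.centralSurfaceSet (fun _ : Fin 3 => (∅ : Set (Metric.sphere (0 : EuclideanSpace ℝ (Fin 5)) 1))) = ∅ :=
    iInter_const _
  obtain ⟨x, hx⟩ := (NormedSpace.sphere_nonempty (x := (0 : EuclideanSpace ℝ (Fin 2))) (r := 1)).mpr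
    zero_le_one
  have hmem : γ ⟨x, hx⟩ ∈ δ := hγ ▸ mem_range_self _
  have : γ ⟨x, hx⟩ ∈ (∅ : Set (Metric.sphere (0 : EuclideanSpace ℝ (Fin 5)) 1)) := hF ▸ hδF hmem
  exact this

end Summit.SmoothPoincare4.SmoothPoincare4.Theorems.MinimalWeaklyReducibleFromFour.Negative

end
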